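import Summits.BirchSwinnertonDyer.Rank1Residual.Partition.Rows
import Literature.NumberTheory.EllipticCurves.Rank1Residual.X9ChaCertificate
import Literature.NumberTheory.EllipticCurves.ComplexMultiplicationNotSemistable
import Literature.NumberTheory.EllipticCurves.BSDRootNumberLocalTablesProofs
import Literature.NumberTheory.EllipticCurves.MultiplicativeComponentGroupOrder
import HarnessLib

/-!
# BSD rank-≤1 residual cell, class X11b (`r = 1 ∧ p ≠ 2 ∧ mult ∧ irr`): the PER-PAIR Cha /
# Heegner-index certificate route at a MULTIPLICATIVE prime (no surjectivity, no (ram), no `sst`)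

HONEST FRAMING (cell `b2b-bsdres-*`, run/shared/lean/b2b/bsd-rank1-residual/, verbatim): the goal
of the cell is to DELETE the COMBINATION-SHAPED residual classes for ALL analytic-rank `≤ 1` elliptic
curves over `ℚ` — "full BSD formula for every rank `≤ 1` curve in class C" assembled STRICTLY from
published theorems — so that the rank-`≤ 1` remainder becomes exactly the CONSTRUCTION-SHAPED
classes, which are TYPED (missing-input Props), NOT attempted; this is not "finishing BSD".
Prove what is provable now; shrink each hard class to its core with data; no claim beyond stated
classes. Research route of unit `b2b-bsdres-x11c` (gen 3); class X11b stays CONSTRUCTION-SHAPED; this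
file is PER PAIR (a certificate shape), not a class theorem; no named fact is introduced.

## What this file does

The unit's RESISTANT list for the `p`-adic certificate route on X11 ∧ `r = 1` ∧ ¬sst ∧ `p ≥ 5`
(HOME/b2b-bsdres-x11c/REPORT.md §4; `N < 5·10⁵`) consists of 64 pairs, all at `p = 5`, with
`ρ̄_{E,5}` IRREDUCIBLE but NOT surjective (Sutherland images `5S4` ×52, `5Ns` ×12) and no (ram)
witness: neither Kato's surjective divisibility (`Wuthrich2014.kato_charIdeal_dvd_multiplicative_of_surjective`)
nor Skinner 2016 Thm. A ((irr) + (ram)) supplies the Iwasawa-theoretic upper bound there. The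
PUBLISHED per-curve input that does apply is B. Cha's extension of Kolyvagin's Heegner-index bound
to irreducible `ρ̄_{E,p}` (J. Number Theory 111 (2005); printed with attribution by Miller, LMS JCM
14 (2011) Thm. 5.2 and Grigorov–Jorza–Patrikis–Stein–Tarniţă, Math. Comp. 78 (2009) Thm. 3.5; tree
fact `Cha2005.thm52_padicValNat_shaOrder_le`, flag `Cha05-primary-unread`), whose reduction
hypothesis is `p² ∤ N` — a MULTIPLICATIVE `p` is allowed (GJPST p. 2406: "Cha's assumption on the
reduction of `E` at `p` … is problematic when there is a prime `p ≥ 5` of additive reduction").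
Its Galois hypotheses are AUTOMATIC on X11b: `E[p]` irreducible is a field of the class, and
`E` is non-CM because a CM curve over `ℚ` has no prime of multiplicative reduction (Silverman,
*Advanced Topics* II.6.4 / proof of II.10.5; tree theorem `Rank1Residual.not_mult_of_hasCM`).

* `bsdp_of_mult_of_chaCertificate` — for ANY globally minimal elliptic `W/ℚ` of analytic rank `≤ 1`,
  an odd prime `p` of multiplicative reduction with `E[p]` irreducible, an imaginary quadratic `K`
  with the Heegner hypothesis for the level `N` of the parametrisation and `p ∤ d_K`, `p² ∤ N`, a
  Heegner point `y_K` of infinite order with `p ∤ [E(K) : ℤ y_K]`, and `p ∤ #Ш_an`: Miller's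
  `BSD(E,p)` — from the tree consumer `Typed.bsdp_of_cha_of_not_dvd_index` (Cha + GZK) with the
  non-CM hypothesis DISCHARGED from `Mult W p`.
* `not_sq_dvd_level_of_isHeegnerPoint` — granted Carayol's theorem (tree named fact
  `IsNewformOf.level_eq_conductorNorm`: the level of the newform of `E` is `N_E`), the level `N` of
  any Heegner datum of `W` is `N_E`, so `p² ∤ N` FOLLOWS from multiplicative reduction at `p`
  (`f_p(E) = 1`; tree theorems `natGenerator_sq_dvd_conductorNorm_iff` [Silverman ATAEC IV.10.2(c)]
  and `HasMultiplicativeReductionAt.not_hasAdditiveReductionAt`);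
  `bsdp_of_mult_of_chaCertificate_of_carayol` — the same certificate WITHOUT the `p² ∤ N` binder.
* `ClassX11b.bsdp_of_chaCertificate`, `ClassX11b.bsdp_of_chaCertificate_of_carayol` — on the cell's
  v5 class `ClassX11b W p := r = 1 ∧ p ≠ 2 ∧ Mult W p ∧ Irr W p` (RESIDUAL-CASES §a.2 row 11;
  `Partition/Rows.lean`) EVERY Galois / reduction hypothesis of Cha's theorem is automatic: what
  remains per pair is the finite certificate (`K`, `y_K`, `p ∤ index`) and `p ∤ #Ш_an`. This is the
  multiplicative-prime analogue of X9's `bsdp_of_classX9_of_chaCertificate` and needs neither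
  `Surj` (Kolyvagin 1990 / Gross 1991) nor (ram) nor semistability.
* `ClassX11b.missingPPartAt_of_chaCertificate` — bookkeeping: the typed missing `p`-part
  (`Typed.MissingPPartAt`) holds at every X11b pair carrying the certificate.

Scope (numbers, not adjectives; HOME/b2b-bsdres-x11c/REPORT.md §11): by Gross–Zagier and the BSD
formula over `K` the index `[E(K) : ℤ y_K]` is divisible by `p` whenever `p ∣ c_q(E)` for some bad
prime `q` (40 of the 64 resistant pairs): there the certificate CANNOT hold and the pair stays
RESISTANT with that named failing hypothesis; the route is aimed at the 24 pairs with
`5 ∤ ∏ c_q` (two-engine Heegner-index certificates: jobs of unit `b2b-bsdres-x11c` gen 3).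

References: B. Cha, J. Number Theory 111 (2005) 154–178 [Cha2005]; R. L. Miller, LMS J. Comput.
Math. 14 (2011) Thm. 5.2, Thm. 4.1, Cor. 4.8 [Miller2011LMS]; Grigorov–Jorza–Patrikis–Stein–Tarniţă,
Math. Comp. 78 (2009) Thm. 3.5, Rem. 3.6 [GrigorovJorzaPatrikisSteinTarnita2009]; B. H. Gross,
in *L-functions and Arithmetic* (1991) [GrossLMS1991]; H. Carayol, Ann. Sci. ÉNS 19 (1986)
[Carayol1986]; J. H. Silverman, *Advanced Topics* (1994) II.6.4, IV.10.2 [SilvermanATAEC1994].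
-/

noncomputable section

open scoped Classical

open WeierstrassCurve Literature.NumberTheory.EllipticCurves
  Literature.NumberTheory.EllipticCurves.ModularForms
  Literature.NumberTheory.EllipticCurves.Rank1Residual
  Literature.NumberTheory.EllipticCurves.Rank1Residual.Typed
  Literature.NumberTheory.EllipticCurves.Cha2005

namespace Summit.BirchSwinnertonDyer.Rank1Residual.X11b

variable (W : WeierstrassCurve ℚ) [W.IsElliptic] [W.IsGloballyMinimal] (p : ℕ) [Fact p.Prime]

/-! ### §1. The Cha certificate at a multiplicative prime -/

/-- **`BSD(E,p)` from Cha's Heegner-index certificate at an odd MULTIPLICATIVE prime with `E[p]`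
irreducible** (image NOT necessarily surjective). PUBLISHED binders: Cha 2005 (`hCha`, as printed by
Miller 2011 Thm. 5.2 / GJPST 2009 Thm. 3.5; flag `Cha05-primary-unread`) and Gross–Zagier–Kolyvagin
(`hGZK`, bsd.S17). Certificate: `K` imaginary quadratic with the Heegner hypothesis for the level `N`
and `p ∤ d_K`, `p² ∤ N`, a Heegner point `P = y_K` of infinite order with `p ∤ [E(K) : ℤ P]`,
`r_an(E) ≤ 1` and `#Ш_an = q` with `ord_p q = 0`. The non-CM hypothesis of Cha's theorem is
discharged: a CM curve has no multiplicative prime (`not_mult_of_hasCM`, Silverman ATAEC II.6.4).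
Per pair; not a class theorem. [cite: Miller2011LMS, Thm. 5.2 (arXiv:1010.2431 p. 11) and Def. 1.1]
[cite: GrigorovJorzaPatrikisSteinTarnita2009, §3.1 Thm. 3.5 (Cha) and the remark after Rem. 3.6 (p. 2406)]
[cite: SilvermanATAEC1994, Thm. II.6.4 (PDF p. 148) and proof of Thm. II.10.5 (PDF p. 172)] -/
theorem bsdp_of_mult_of_chaCertificate (hCha : thm52_padicValNat_shaOrder_le)
    (hGZK : rank_eq_analyticRank_of_analyticRank_le_one)
    (hmult : Mult W p) (hp2 : p ≠ 2) (hirr : Irr W p)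
    {N : ℕ} [NeZero N] {K : Type} [Field K] [NumberField K] (hK : IsImaginaryQuadratic K)
    (hH : SatisfiesHeegnerHypothesis N K) {P : (W.baseChange K).toAffine.Point}
    (hP : IsHeegnerPoint N W K P) (hnt : ¬ IsOfFinAddOrder P)
    (hpD : ¬ (p : ℤ) ∣ NumberField.discr K) (hpN : ¬ p ^ 2 ∣ N)
    (hI : ¬ p ∣ (AddSubgroup.zmultiples P).index)
    (hr : W.analyticRank ≤ 1) {q : ℚ} (hq : shaAn W = (q : ℂ)) (hv : padicValRat p q = 0) :
    BSDp W p :=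
  Typed.bsdp_of_cha_of_not_dvd_index W p hCha hGZK hK hH hP hnt
    (fun hCM ↦ not_mult_of_hasCM W hCM p hmult) hp2 hpD hpN hirr hI hr hq hv

/-! ### §2. `p² ∤ N` from multiplicative reduction, granted Carayol's theorem -/

omit [W.IsGloballyMinimal] in
/-- **`p² ∤ N_E` at a multiplicative prime**: the conductor exponent at a prime of multiplicative
reduction is `1` (Silverman ATAEC IV.10.2(b),(c); tree: `p² ∣ N_E ↔` additive at the place over `p`,
`natGenerator_sq_dvd_conductorNorm_iff`, and multiplicative excludes additive). [cite: Silverman1994, IV.10.2(c)] -/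
theorem not_sq_dvd_conductorNorm_of_mult (hmult : Mult W p) : ¬ p ^ 2 ∣ W.conductorNorm ℤ := by
  have hp : p.Prime := Fact.out
  set v : IsDedekindDomain.HeightOneSpectrum ℤ :=
    (Rat.HeightOneSpectrum.primesEquiv (R := ℤ)).symm ⟨p, hp⟩ with hv
  have hgen : Rat.HeightOneSpectrum.natGenerator v = p := natGenerator_primesEquiv_symm hp
  have hmv : W.HasMultiplicativeReductionAt v :=
    (W.hasMultiplicativeReductionAtPrime_iff_hasMultiplicativeReductionAt_holds ⟨p, hp⟩).mp hmult
  intro h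
  rw [← hgen] at h
  exact hmv.not_hasAdditiveReductionAt ((natGenerator_sq_dvd_conductorNorm_iff v W).mp h)

omit [W.IsGloballyMinimal] [Fact p.Prime] in
/-- **The level of a Heegner datum is the conductor**, granted Carayol's theorem (`hC`, tree named
fact `IsNewformOf.level_eq_conductorNorm`: a newform `f ∈ S₂(Γ₀(N))` with `aₙ(f) = aₙ(E)` has
`N = N_E`): the parametrisation datum inside `IsHeegnerPoint N W K P` carries such a newform.
[cite: Carayol1986, Thm. (A) (niveau de la newform = conducteur)] [cite: Gross1984, §§3–4] -/
theorem level_eq_conductorNorm_of_isHeegnerPoint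
    (hC : ∀ (M : ℕ) [NeZero M], IsNewformOf.level_eq_conductorNorm (N := M))
    {N : ℕ} [NeZero N] {K : Type} [Field K] [NumberField K]
    {P : (W.baseChange K).toAffine.Point} (hP : IsHeegnerPoint N W K P) :
    N = W.conductorNorm ℤ := by
  obtain ⟨Dt, -, -, -⟩ := hP
  exact hC N Dt.isNewformOf

omit [W.IsGloballyMinimal] in
/-- **`p² ∤ N` for the level `N` of any Heegner datum of `E` at a multiplicative prime `p`**, granted
Carayol's theorem `hC` (`N = N_E`) — the binder `hpN` of Cha's theorem DISCHARGED on X11b.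
[cite: Carayol1986, Thm. (A)] [cite: Silverman1994, IV.10.2(c)] -/
theorem not_sq_dvd_level_of_isHeegnerPoint
    (hC : ∀ (M : ℕ) [NeZero M], IsNewformOf.level_eq_conductorNorm (N := M)) (hmult : Mult W p)
    {N : ℕ} [NeZero N] {K : Type} [Field K] [NumberField K]
    {P : (W.baseChange K).toAffine.Point} (hP : IsHeegnerPoint N W K P) : ¬ p ^ 2 ∣ N := by
  rw [level_eq_conductorNorm_of_isHeegnerPoint W hC hP]
  exact not_sq_dvd_conductorNorm_of_mult W p hmult

/-- **`BSD(E,p)` from Cha's certificate at an odd multiplicative prime, `p² ∤ N` discharged by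
Carayol's theorem** (`hC`; eleven-th published input). Same certificate as
`bsdp_of_mult_of_chaCertificate` minus the binder `hpN`. Per pair; not a class theorem.
[cite: Miller2011LMS, Thm. 5.2 and Def. 1.1] [cite: Carayol1986, Thm. (A)] -/
theorem bsdp_of_mult_of_chaCertificate_of_carayol (hCha : thm52_padicValNat_shaOrder_le)
    (hGZK : rank_eq_analyticRank_of_analyticRank_le_one)
    (hC : ∀ (M : ℕ) [NeZero M], IsNewformOf.level_eq_conductorNorm (N := M))
    (hmult : Mult W p) (hp2 : p ≠ 2) (hirr : Irr W p)
    {N : ℕ} [NeZero N] {K : Type} [Field K] [NumberField K] (hK : IsImaginaryQuadratic K)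
    (hH : SatisfiesHeegnerHypothesis N K) {P : (W.baseChange K).toAffine.Point}
    (hP : IsHeegnerPoint N W K P) (hnt : ¬ IsOfFinAddOrder P)
    (hpD : ¬ (p : ℤ) ∣ NumberField.discr K) (hI : ¬ p ∣ (AddSubgroup.zmultiples P).index)
    (hr : W.analyticRank ≤ 1) {q : ℚ} (hq : shaAn W = (q : ℂ)) (hv : padicValRat p q = 0) :
    BSDp W p :=
  bsdp_of_mult_of_chaCertificate W p hCha hGZK hmult hp2 hirr hK hH hP hnt hpD
    (not_sq_dvd_level_of_isHeegnerPoint W p hC hmult hP) hI hr hq hv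

/-! ### §3. On the cell's class X11b every Galois / reduction hypothesis is automatic -/

/-- **X11b, `p ∤ #Ш_an`: `BSD(E,p)` from PUBLISHED theorems plus the Cha index certificate.** On
`ClassX11b W p` (`r = 1 ∧ p ≠ 2 ∧ mult(p) ∧ irr(p)`, RESIDUAL-CASES §a.2 v5 row 11) the hypotheses
"`E` non-CM", "`p` odd", "`ρ̄_{E,p}` irreducible", "`r_an ≤ 1`" of Cha's theorem hold by definition of
the class (non-CM via `not_mult_of_hasCM`); no surjectivity, no (ram) witness, no semistability is
asked. What remains per pair: the Heegner field `K` (`p ∤ d_K`), `p² ∤ N`, the Heegner point `y_K` of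
infinite order with `p ∤ [E(K) : ℤ y_K]`, and `p ∤ #Ш_an`. NOT a class theorem; X11b's label is
unchanged. [cite: Miller2011LMS, Thm. 5.2 and Def. 1.1]
[cite: GrigorovJorzaPatrikisSteinTarnita2009, §3.1 Thm. 3.5 (Cha)] -/
theorem ClassX11b.bsdp_of_chaCertificate (hCha : thm52_padicValNat_shaOrder_le)
    (hGZK : rank_eq_analyticRank_of_analyticRank_le_one) (hX : ClassX11b W p)
    {N : ℕ} [NeZero N] {K : Type} [Field K] [NumberField K] (hK : IsImaginaryQuadratic K)
    (hH : SatisfiesHeegnerHypothesis N K) {P : (W.baseChange K).toAffine.Point}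
    (hP : IsHeegnerPoint N W K P) (hnt : ¬ IsOfFinAddOrder P)
    (hpD : ¬ (p : ℤ) ∣ NumberField.discr K) (hpN : ¬ p ^ 2 ∣ N)
    (hI : ¬ p ∣ (AddSubgroup.zmultiples P).index)
    {q : ℚ} (hq : shaAn W = (q : ℂ)) (hv : padicValRat p q = 0) : BSDp W p := by
  obtain ⟨hr1, hp2, hmult, hirr⟩ := hX
  exact bsdp_of_mult_of_chaCertificate W p hCha hGZK hmult hp2 hirr hK hH hP hnt hpD hpN hI
    (le_of_eq hr1) hq hv

/-- **X11b, `p ∤ #Ш_an`, Carayol granted: `BSD(E,p)` from the Cha certificate with `p² ∤ N`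
discharged.** [cite: Miller2011LMS, Thm. 5.2 and Def. 1.1] [cite: Carayol1986, Thm. (A)] -/
theorem ClassX11b.bsdp_of_chaCertificate_of_carayol (hCha : thm52_padicValNat_shaOrder_le)
    (hGZK : rank_eq_analyticRank_of_analyticRank_le_one)
    (hC : ∀ (M : ℕ) [NeZero M], IsNewformOf.level_eq_conductorNorm (N := M)) (hX : ClassX11b W p)
    {N : ℕ} [NeZero N] {K : Type} [Field K] [NumberField K] (hK : IsImaginaryQuadratic K)
    (hH : SatisfiesHeegnerHypothesis N K) {P : (W.baseChange K).toAffine.Point}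
    (hP : IsHeegnerPoint N W K P) (hnt : ¬ IsOfFinAddOrder P)
    (hpD : ¬ (p : ℤ) ∣ NumberField.discr K) (hI : ¬ p ∣ (AddSubgroup.zmultiples P).index)
    {q : ℚ} (hq : shaAn W = (q : ℂ)) (hv : padicValRat p q = 0) : BSDp W p := by
  obtain ⟨hr1, hp2, hmult, hirr⟩ := hX
  exact bsdp_of_mult_of_chaCertificate_of_carayol W p hCha hGZK hC hmult hp2 hirr hK hH hP hnt hpD
    hI (le_of_eq hr1) hq hv

/-- **X11b: the typed missing `p`-part is DISCHARGED, pair by pair, by the Cha certificate** (for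
`p ∤ #Ш_an`): `Typed.MissingPPartAt W p` holds at every X11b pair carrying the certificate (Ш is
finite by GZK in analytic rank `1`). Bookkeeping only; the class stays typed.
[cite: Miller2011LMS, Thm. 5.2 and Def. 1.1] -/
theorem ClassX11b.missingPPartAt_of_chaCertificate (hCha : thm52_padicValNat_shaOrder_le)
    (hGZK : rank_eq_analyticRank_of_analyticRank_le_one) (hX : ClassX11b W p)
    {N : ℕ} [NeZero N] {K : Type} [Field K] [NumberField K] (hK : IsImaginaryQuadratic K)
    (hH : SatisfiesHeegnerHypothesis N K) {P : (W.baseChange K).toAffine.Point}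
    (hP : IsHeegnerPoint N W K P) (hnt : ¬ IsOfFinAddOrder P)
    (hpD : ¬ (p : ℤ) ∣ NumberField.discr K) (hpN : ¬ p ^ 2 ∣ N)
    (hI : ¬ p ∣ (AddSubgroup.zmultiples P).index)
    {q : ℚ} (hq : shaAn W = (q : ℂ)) (hv : padicValRat p q = 0) : MissingPPartAt W p := by
  haveI : Finite W.sha := (hGZK W (le_of_eq hX.1)).2
  exact missingPPartAt_of_bsdp W p
    (ClassX11b.bsdp_of_chaCertificate W p hCha hGZK hX hK hH hP hnt hpD hpN hI hq hv)

end Summit.BirchSwinnertonDyer.Rank1Residual.X11b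

end
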